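import Summits.CriticalPhenomena.SAWScalingLimit.Theses.SAWSpinMonotone

/-!
# Sketch — crux-ideate stmt-CriticalPhenomena-16772 (`SAWSpinMonotone.QCIdentification`), ideator 2, round 1

Card `boundary-torque-circulation`.  First-lemma signatures only (nothing proved here).

The **torque kernel** of a finite hexagonal domain `Λ`: for two dangling (boundary) mid-edges
`a = {v₀, nbr v₀ k₀}` and `p = {v, nbr v k}` put

  `g_Λ(a, p) := Im ( conj(mid a − c(v₀)) · (mid p − c(v)) · F_{Λ,a}(p) )`,

`F_{Λ,a} = hexParafermionicObservable Λ a x_c (5/8)` — the component of the developed boundary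
increment `(p − v) F_a(p)` TRANSVERSE to the source's own outward direction.  Two atomic facts:

* (T1) `g_Λ(a,p) = −g_Λ(p,a)` — walk REVERSAL (`Z(a→p) = Z(p→a)`, `W ↦ −W`), any finite `Λ`;
* (T2) `Σ_p g_Λ(a,p) = 0` for every dangling `a` — Duminil-Copin–Smirnov Lemma 1 summed over `Λ`
  (interior mid-edges cancel) plus `F_a(a) = 1`, whose own term `|mid a − c v₀|² · 1` is real.

So `g_Λ` is a CIRCULATION on the set of boundary mid-edges (antisymmetric, divergence-free), hence has
zero flux across every cut `S | ∂Λ∖S` (`TorqueCut`).  For simply connected `Λ` every summand is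
`−(1/12)·sin((3/8)·W(a→p))·Z(a→p)` with the deterministic winding `W`, so for `S = S_↓` (all
downward dangling mid-edges — a flat zigzag wall) the cut identity reads
`Σ_{p ∉ S_↓} sin((3/8) W_{S_↓}(p)) · B_{S_↓}(p) = 0`, `B_{S_↓}(p) = Σ_{a∈S_↓} Z(a→p) = Z(p → S_↓)` the
ESCAPE generating function (`DownwardTorqueBalance`; verified by exact enumeration to 1e−16 on ten
mound domains, |Λ| ≤ 37, exp/torque*.py).  In an infinite periodic strip (flat near wall, arbitrary
periodic far wall) regrouping by translations gives the facet-torque balance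
`Σ_{c ∈ period} sin((3/8) W_c) · B_W(c) = 0` EXACTLY at every width `W` (e.g. for the chiral wall
`w₆ = (60,60,0,−60,0,−60)`: bridges from the two risers = bridges from the two falls), and locality of
boundary factors (`EscapeArrivalLocality`) turns it into ZERO TWIST `Σ_c sin((3/8)W_c) ρ_c = 0`.
-/

namespace Summit.CriticalPhenomena.SAWScalingLimit.Cruxes.QCIdentification.Torque

open scoped BigOperators ComplexConjugate
open Literature.Probability.LatticeModels Literature.Probability.RandomPlanarGeometry.SAW
open Classical

noncomputable section

/-- The three neighbours of a hexagonal vertex (up face `(x,0)`: `(x,1)` at 30°, `(x-e₀,1)` at 150°,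
`(x-e₁,1)` at 270° = DOWN; down face `(y,1)`: `(y,0)` at 210°, `(y+e₀,0)` at 330°, `(y+e₁,0)` at 90°). -/
def nbr (v : HexVertex) (k : Fin 3) : HexVertex :=
  if v.2 = 0 then
    ![(v.1, 1), (v.1 - Pi.single 0 1, 1), (v.1 - Pi.single 1 1, 1)] k
  else
    ![(v.1, 0), (v.1 + Pi.single 0 1, 0), (v.1 + Pi.single 1 1, 0)] k

/-- The critical observable `F_{Λ,a}(·) = F(a, ·, x_c, 5/8)`. -/
def Fc (Λ : Finset HexVertex) (a : Sym2 HexVertex) : Sym2 HexVertex → ℂ :=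
  hexParafermionicObservable Λ a hexCriticalFugacity (5 / 8)

/-- The (un-normalised) outward vector `mid p − c(v)` of the mid-edge from `v` towards `nbr v k`
(length `√3/6` for every `v`, `k`). -/
def outVec (v : HexVertex) (k : Fin 3) : ℂ := hexMidpoint s(v, nbr v k) - hexCenter v

/-- **Torque kernel** `g_Λ((v₀,k₀),(v,k)) = Im( conj(outVec v₀ k₀) · outVec v k · F_{Λ,a}(p) )`,
`a = {v₀, nbr v₀ k₀}`, `p = {v, nbr v k}`: the transverse (to `a`'s own direction) component of the
developed boundary increment of `p` seen from the source `a`.  For simply connected `Λ` and dangling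
`a ≠ p` it equals `−(1/12) sin((3/8) W(a→p)) Z(a→p)` (deterministic winding, positive generating
function). -/
def torque (Λ : Finset HexVertex) (v₀ : HexVertex) (k₀ : Fin 3) (v : HexVertex) (k : Fin 3) : ℝ :=
  (conj (outVec v₀ k₀) * outVec v k * Fc Λ s(v₀, nbr v₀ k₀) s(v, nbr v k)).im

/-- (T1) **Reversal antisymmetry** of the torque kernel between two dangling mid-edges: every walk
`a → p` reversed is a walk `p → a` of the same length and opposite winding, and
`Im(conj d₀ · d · e^{-iσW}) + Im(conj d · d₀ · e^{+iσW}) = 0`.  Provable now (size M). -/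
def TorqueAntisymm : Prop :=
  ∀ (Λ : Finset HexVertex) (v₀ v : HexVertex) (k₀ k : Fin 3),
    v₀ ∈ Λ → v ∈ Λ → nbr v₀ k₀ ∉ Λ → nbr v k ∉ Λ →
      torque Λ v₀ k₀ v k = - torque Λ v k v₀ k₀

/-- (T2) **Zero divergence**: for every dangling source `a = {v₀, nbr v₀ k₀}` the torques of ALL
dangling mid-edges sum to zero — Lemma 1 (`DuminilCopinSmirnov2012_lemma1_holds`) summed over `v ∈ Λ`
(interior mid-edges cancel since `mid p − c v + (mid p − c v') = 0`), the `p = a` term being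
`Im(|outVec v₀ k₀|² · F_a(a)) = Im(1/12 · 1) = 0`.  Provable now (size M). -/
def TorqueDivergenceFree : Prop :=
  ∀ (Λ : Finset HexVertex), hexDomainSimplyConnected Λ → ∀ v₀ ∈ Λ, ∀ k₀ : Fin 3, nbr v₀ k₀ ∉ Λ →
    (∑ v ∈ Λ, ∑ k : Fin 3, if nbr v k ∈ Λ then 0 else torque Λ v₀ k₀ v k) = 0

/-- **Master torque identity (zero flux across every cut).** For every set `S` of dangling mid-edges
(given by a predicate on `(v,k)`), the total torque exerted on `∂Λ ∖ S` by all sources in `S` vanishes.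
Two-line consequence of (T1)+(T2). -/
def TorqueCut : Prop :=
  ∀ (Λ : Finset HexVertex), hexDomainSimplyConnected Λ → ∀ S : HexVertex → Fin 3 → Prop,
    (∑ v₀ ∈ Λ, ∑ k₀ : Fin 3, ∑ v ∈ Λ, ∑ k : Fin 3,
      if nbr v₀ k₀ ∉ Λ ∧ S v₀ k₀ ∧ nbr v k ∉ Λ ∧ ¬ S v k then torque Λ v₀ k₀ v k else 0) = 0

/-- **First lemma of the card (checkable, provable now): downward torque balance.**  With
`S_↓ = ` all DOWNWARD dangling mid-edges `{(x,0), (x−e₁,1)}` (every flat zigzag bottom piece of `Λ`, at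
any rows), the torque exerted by `S_↓` on the rest of the boundary vanishes.  Unfolded for simply
connected `Λ`: `Σ_{p ∉ S_↓} sin((3/8)·W_{S_↓}(p)) · Z(p → S_↓) = 0`, where `Z(p → S_↓) = Σ_{a ∈ S_↓} Z(a → p)`
is the escape generating function from the facet `p` to the flat bottom and `W_{S_↓}(p)` the
(source-independent) winding from the bottom to `p` — e.g. on any 𝕋-excursion mound over a flat base
with steps in `{0°, ±60°}`: (total escape weight from the rising facets) = (that from the falling facets).
Exact enumeration (exp/torque.py, tree conventions): defect ≤ 1.2e−15 on ten mounds incl. caves and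
overhangs, |Λ| ≤ 37. -/
def DownwardTorqueBalance : Prop :=
  ∀ (Λ : Finset HexVertex), hexDomainSimplyConnected Λ →
    (∑ v₀ ∈ Λ.filter (fun w => w.2 = 0 ∧ nbr w 2 ∉ Λ), ∑ v ∈ Λ, ∑ k : Fin 3,
      if nbr v k ∈ Λ ∨ (v.2 = 0 ∧ k = 2) then 0 else torque Λ v₀ 2 v k) = 0

/-- The escape generating function of a mid-edge `p` to the flat bottom(s): `Σ_{a ∈ S_↓} |F_{Λ,a}(p)|`
(`= Σ_{a∈S_↓} Z(a→p) = Z(p → S_↓)` by reversal). -/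
def escapeDown (Λ : Finset HexVertex) (p : Sym2 HexVertex) : ℝ :=
  ∑ w ∈ Λ.filter (fun w => w.2 = 0 ∧ nbr w 2 ∉ Λ), ‖Fc Λ s(w, nbr w 2) p‖

/-- **Escape/arrival locality (the residual, Kennedy–Lawler type; open, size L).**  The RATIO of the
boundary amplitudes of two nearby facets `p = {v, nbr v k}`, `p' = {v', nbr v' k'}` does not depend on
the far excitation: escape to a far flat bottom and arrival from a far point source `a` give the same
ratio up to `ε`, uniformly, once bottom and source are at distance `≥ R` from the facets.  (With
`DownwardTorqueBalance` in a periodic strip this is exactly what converts the exact bridge balance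
`Σ_c sin((3/8)W_c) B_W(c) = 0` into the zero-twist balance `Σ_c sin((3/8)W_c) ρ_c = 0` of the
developed map's boundary factors.) -/
def EscapeArrivalLocality : Prop :=
  ∀ ε : ℝ, 0 < ε → ∃ R : ℝ, ∀ (Λ : Finset HexVertex), hexDomainSimplyConnected Λ →
    ∀ a ∈ hexDomainBoundary Λ, ∀ (v v' : HexVertex) (k k' : Fin 3),
      v ∈ Λ → v' ∈ Λ → nbr v k ∉ Λ → nbr v' k' ∉ Λ → ¬ (v.2 = 0 ∧ k = 2) → ¬ (v'.2 = 0 ∧ k' = 2) →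
      dist (hexCenter v) (hexCenter v') ≤ 2 →
      R ≤ dist (hexMidpoint a) (hexCenter v) →
      (∀ w ∈ Λ, w.2 = 0 → nbr w 2 ∉ Λ → R ≤ dist (hexCenter w) (hexCenter v)) →
      let p : Sym2 HexVertex := s(v, nbr v k)
      let p' : Sym2 HexVertex := s(v', nbr v' k')
      |escapeDown Λ p * ‖Fc Λ a p'‖ - escapeDown Λ p' * ‖Fc Λ a p‖| ≤ ε * (escapeDown Λ p' * ‖Fc Λ a p‖)

end

end Summit.CriticalPhenomena.SAWScalingLimit.Cruxes.QCIdentification.Torque
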